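import Mathlib
import Summits.ValiantsHypothesis.ValiantsHypothesis.Theorems.BarrierLeverPartitionMinorsHitByVPHiddenStatesTwoUnfedPeel

/-!
# Route BarrierLever — item `PartitionMinorsHitByVP` (stmt-ValiantsHypothesis-19717), line `hidden-states`:
# ★ THEOREM 2U — TWO UNFED TOKENS WITH DISJOINT SOURCES MAKE THE CROSS MINOR VANISH

Helper file (`--supports stmt-ValiantsHypothesis-19717`; cell valiant-natproofs, 𝒟-side door (c), registered line
`Cruxes/PartitionMinorsHitByVP/Lines/hidden_states.lean` v8; prover seat val-np-p6 gen 17).  Closes NO item.  Definition: `extBall` (extension by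
zero from the ball; transparent).

THEOREM 2U (memo HOME/val-np-p6/g17/MEMO-valnp6-g17.md §4).  Table `w` (any), rows `(B_t ∖ {A}) ∪ {C'}` with `|A| = t`, `|C'| = t+1`,
columns the points of size `≤ t`.  If `q₁ ≠ q₂ ∈ C' ∖ A` are UNFED (`w q_i q_i = 1`, `w a q_i = 0` for `a ≠ q_i`: nobody's source) with
DISJOINT SOURCES (`w q₁ d · w q₂ d = 0`), then the monomial matrix is singular (★ `det_eq_zero_of_two_unfed`).
Proof: the double peel `E = peelOp q₂ ∘ peelOp q₁` (`…TwoUnfedPeel`) evaluated on `q`-free `t`-sets sends the coefficient vector of every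
row to `0`, except the `q`-free rows of size `t`, which it fixes; a nonzero functional `κ` on functions of `q`-free `t`-sets killing the
coefficient vectors of those rows (all `≠ A`: one fewer than the dimension) gives `θ = κ ∘ E ≠ 0` killing EVERY row's coefficient vector; the
`r ≥ |B_t|` coefficient vectors then lie in `ker θ` of dimension `|B_t| − 1`, so they — and with them the rows of the monomial matrix — are dependent.
This is the cancellation mechanism behind the «entangled» second-shell classes (e.g. t = 2: {01,02;123,124}); with `…SecondShellExchange` it
serves them.

WHAT THIS IS NOT: no cell is stated here (orientation control is the sequel); nothing on crux 14610 or VP ≠ VNP.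
-/

set_option linter.dupNamespace false

namespace Summit.ValiantsHypothesis.ValiantsHypothesis.Theorems.BarrierLever.HiddenStates

open Finset

noncomputable section

namespace SecondShell

open PathTable (mono_expand)

variable {ι : Type} [Fintype ι] [DecidableEq ι]

/-- extension by zero of a function on the ball of radius `t`. -/
def extBall (t : ℕ) (g : {R : Finset ι // R.card ≤ t} → ℂ) : Finset ι → ℂ :=
  fun R => if h : R.card ≤ t then g ⟨R, h⟩ else 0

omit [Fintype ι] in
/-- the peel operator at `R ∌ q` only reads sets of the same cardinality as `R`. -/
theorem peelOp_congr_card (w : ι → ι → ℂ) {q : ι} {c c' : Finset ι → ℂ} {R : Finset ι} (hq : q ∉ R)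
    (h : ∀ X : Finset ι, X.card = R.card → c X = c' X) : peelOp w q c R = peelOp w q c' R := by
  refine peelOp_congr w q (h R rfl) fun d hd => h _ ?_
  rw [Finset.card_insert_of_notMem (fun h' => hq (Finset.mem_of_mem_erase h')), Finset.card_erase_of_mem hd]
  have := Finset.card_pos.2 ⟨d, hd⟩; omega

omit [Fintype ι] in
/-- the double peel at a `q`-free `R` only reads sets of cardinality `|R|`. -/
theorem doublePeel_congr_card (w : ι → ι → ℂ) {q₁ q₂ : ι} (hne : q₁ ≠ q₂) {c c' : Finset ι → ℂ} {R : Finset ι}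
    (h₁ : q₁ ∉ R) (h₂ : q₂ ∉ R) (h : ∀ X : Finset ι, X.card = R.card → c X = c' X) :
    peelOp w q₂ (peelOp w q₁ c) R = peelOp w q₂ (peelOp w q₁ c') R := by
  refine peelOp_congr w q₂ (peelOp_congr_card w h₁ h) fun d hd => ?_
  have hcard : (insert q₂ (R.erase d)).card = R.card := by
    rw [Finset.card_insert_of_notMem (fun h' => h₂ (Finset.mem_of_mem_erase h')), Finset.card_erase_of_mem hd]
    have := Finset.card_pos.2 ⟨d, hd⟩; omega
  exact peelOp_congr_card w (notMem_insert_erase hne h₁ d) fun X hX => h X (hX.trans hcard)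

omit [Fintype ι] in
/-- the peel operator is additive and homogeneous in the function. -/
theorem peelOp_add (w : ι → ι → ℂ) (q : ι) (c c' : Finset ι → ℂ) (R : Finset ι) :
    peelOp w q (c + c') R = peelOp w q c R + peelOp w q c' R := by
  simp only [peelOp, Pi.add_apply, mul_add, Finset.sum_add_distrib]; ring

omit [Fintype ι] in
/-- homogeneity of the peel operator. -/
theorem peelOp_smul (w : ι → ι → ℂ) (q : ι) (a : ℂ) (c : Finset ι → ℂ) (R : Finset ι) :
    peelOp w q (a • c) R = a * peelOp w q c R := by
  simp only [peelOp, Pi.smul_apply, smul_eq_mul]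
  rw [mul_sub, Finset.mul_sum]
  congr 1
  exact Finset.sum_congr rfl fun d _ => by ring

omit [Fintype ι] in
/-- pointwise-equal functions have equal peels. -/
theorem peelOp_fun_congr (w : ι → ι → ℂ) (q : ι) {c c' : Finset ι → ℂ} (h : ∀ X, c X = c' X) (R : Finset ι) :
    peelOp w q c R = peelOp w q c' R := peelOp_congr w q (h R) (fun _ _ => h _)

/-- ★ **The double peel on the rows.**  For `S` with `|S| ≤ t + 1` and `|S| = t + 1 ⇒ q₁, q₂ ∈ S`, at a `q`-free `R` with `|R| = t`:
`E(coef S)(R) = coef S R` if `S` is `q`-free, and `0` otherwise. -/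
theorem doublePeel_coef_row (w : ι → ι → ℂ) {q₁ q₂ : ι} (hne : q₁ ≠ q₂)
    (hcol₁ : ∀ a, a ≠ q₁ → w a q₁ = 0) (hcol₂ : ∀ a, a ≠ q₂ → w a q₂ = 0) (hq₁ : w q₁ q₁ = 1) (hq₂ : w q₂ q₂ = 1)
    (hdisj : ∀ d, d ≠ q₁ → d ≠ q₂ → w q₁ d * w q₂ d = 0) {t : ℕ}
    {S : Finset ι} (hS1 : S.card ≤ t + 1) (hS2 : S.card = t + 1 → q₁ ∈ S ∧ q₂ ∈ S)
    {R : Finset ι} (hR : R.card = t) (h₁R : q₁ ∉ R) (h₂R : q₂ ∉ R) :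
    peelOp w q₂ (peelOp w q₁ (coef w S)) R = if q₁ ∉ S ∧ q₂ ∉ S then coef w S R else 0 := by
  classical
  by_cases h1 : q₁ ∈ S
  · rw [if_neg (fun h => h.1 h1)]
    by_cases h2 : q₂ ∈ S
    · -- both present
      set S'' := (S.erase q₁).erase q₂ with hS''
      have hSeq : S = insert q₁ (insert q₂ S'') := by
        rw [hS'', Finset.insert_erase (Finset.mem_erase.2 ⟨hne.symm, h2⟩), Finset.insert_erase h1]
      have h2card : 2 ≤ S.card := by
        have hsub : ({q₁, q₂} : Finset ι) ⊆ S := by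
          intro x hx; rcases Finset.mem_insert.1 hx with rfl | hx
          · exact h1
          · rw [Finset.mem_singleton.1 hx]; exact h2
        have := Finset.card_le_card hsub; rw [Finset.card_pair hne] at this; exact this
      have hc'' : S''.card < R.card := by
        rw [hS'', Finset.card_erase_of_mem (Finset.mem_erase.2 ⟨hne.symm, h2⟩), Finset.card_erase_of_mem h1]; omega
      rw [hSeq, doublePeel_coef_both w hne hcol₁ hcol₂ hq₁ hq₂ hdisj (by simp [hS'']) (by simp [hS'']) h₁R h₂R,
        coef_eq_zero_of_card_lt w hc'', mul_zero]
    · -- only `q₁`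
      set S' := S.erase q₁ with hS'
      have hSeq : S = insert q₁ S' := by rw [hS', Finset.insert_erase h1]
      have hSt : S.card ≤ t := by
        by_contra hlt
        exact h2 (hS2 (by omega)).2
      have h1card : 1 ≤ S.card := Finset.card_pos.2 ⟨q₁, h1⟩
      have hc' : S'.card < R.card := by rw [hS', Finset.card_erase_of_mem h1]; omega
      have h2' : q₂ ∉ S' := fun h => h2 (Finset.mem_of_mem_erase h)
      rw [hSeq, doublePeel_coef_one w hne hcol₁ hcol₂ hq₁ (by simp [hS']) h2' h₁R, coef_eq_zero_of_card_lt w hc', mul_zero]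
  · by_cases h2 : q₂ ∈ S
    · rw [if_neg (fun h => h.2 h2)]
      set S' := S.erase q₂ with hS'
      have hSeq : S = insert q₂ S' := by rw [hS', Finset.insert_erase h2]
      have hSt : S.card ≤ t := by
        by_contra hlt
        exact h1 (hS2 (by omega)).1
      have h1card : 1 ≤ S.card := Finset.card_pos.2 ⟨q₂, h2⟩
      have hc' : S'.card < R.card := by rw [hS', Finset.card_erase_of_mem h2]; omega
      have h1' : q₁ ∉ S' := fun h => h1 (Finset.mem_of_mem_erase h)
      rw [hSeq, doublePeel_coef_two w hne hcol₁ hcol₂ hq₂ h1' (by simp [hS']) h₂R, coef_eq_zero_of_card_lt w hc', mul_zero]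
    · rw [if_pos ⟨h1, h2⟩]
      exact doublePeel_coef_free w hcol₁ hcol₂ h1 h2

/-- ★ **THEOREM 2U.**  Two unfed tokens of `C' ∖ A` with disjoint sources ⇒ the monomial matrix of the rows `(B_t ∖ {A}) ∪ {C'}` against the
points of size `≤ t` is singular. -/
theorem det_eq_zero_of_two_unfed (w : ι → ι → ℂ) {q₁ q₂ : ι} (hne : q₁ ≠ q₂)
    (hcol₁ : ∀ a, a ≠ q₁ → w a q₁ = 0) (hcol₂ : ∀ a, a ≠ q₂ → w a q₂ = 0) (hq₁ : w q₁ q₁ = 1) (hq₂ : w q₂ q₂ = 1)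
    (hdisj : ∀ d, d ≠ q₁ → d ≠ q₂ → w q₁ d * w q₂ d = 0)
    (t : ℕ) {r : ℕ} (u colJ : Fin r → Finset ι) (hcol : ∀ kk, (colJ kk).card ≤ t)
    (i₀ : Fin r) (hC : (u i₀).card = t + 1) (h₁C : q₁ ∈ u i₀) (h₂C : q₂ ∈ u i₀)
    (A : Finset ι) (hAcard : A.card = t) (h₁A : q₁ ∉ A) (h₂A : q₂ ∉ A) (hA : ∀ i, u i ≠ A)
    (hrows : ∀ i, i ≠ i₀ → (u i).card ≤ t)
    (hall : ∀ R : Finset ι, R.card ≤ t → R ≠ A → ∃ i, i ≠ i₀ ∧ u i = R) :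
    (Matrix.of fun i kk : Fin r => ∏ a ∈ u i, ∑ q ∈ colJ kk, w a q).det = 0 := by
  classical
  -- types: the ball and the `q`-free `t`-sets
  set Bt := {R : Finset ι // R.card ≤ t}
  set Tq := {R : Finset ι // R.card = t ∧ q₁ ∉ R ∧ q₂ ∉ R}
  -- coefficient vectors of the rows
  let v : Fin r → Bt → ℂ := fun i R => coef w (u i) R.1
  -- every row satisfies the shape hypothesis of `doublePeel_coef_row`
  have hshape : ∀ i, (u i).card ≤ t + 1 ∧ ((u i).card = t + 1 → q₁ ∈ u i ∧ q₂ ∈ u i) := by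
    intro i
    by_cases hi : i = i₀
    · subst hi; exact ⟨by omega, fun _ => ⟨h₁C, h₂C⟩⟩
    · have := hrows i hi; exact ⟨by omega, fun h => by omega⟩
  -- the `q`-free coefficient vectors of the `q`-free `t`-rows other than `A` span a proper subspace
  let vec : Finset ι → Tq → ℂ := fun S R => coef w S R.1
  set gens : Finset (Tq → ℂ) :=
    (Finset.univ.filter fun S : Finset ι => S.card = t ∧ q₁ ∉ S ∧ q₂ ∉ S ∧ S ≠ A).image vec with hgens
  set P : Submodule ℂ (Tq → ℂ) := Submodule.span ℂ (↑gens : Set (Tq → ℂ)) with hP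
  have hTq : Fintype.card Tq = (Finset.univ.filter fun S : Finset ι => S.card = t ∧ q₁ ∉ S ∧ q₂ ∉ S).card := by
    simp only [Tq]; rw [Fintype.card_subtype]
  have hgens_card : gens.card + 1 ≤ Fintype.card Tq := by
    rw [hTq]
    refine le_trans (Nat.add_le_add_right Finset.card_image_le 1) ?_
    have hAmem : A ∈ Finset.univ.filter (fun S : Finset ι => S.card = t ∧ q₁ ∉ S ∧ q₂ ∉ S) :=
      Finset.mem_filter.2 ⟨Finset.mem_univ _, hAcard, h₁A, h₂A⟩
    have hsub : Finset.univ.filter (fun S : Finset ι => S.card = t ∧ q₁ ∉ S ∧ q₂ ∉ S ∧ S ≠ A) =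
        (Finset.univ.filter (fun S : Finset ι => S.card = t ∧ q₁ ∉ S ∧ q₂ ∉ S)).erase A := by
      ext S
      simp only [Finset.mem_filter, Finset.mem_univ, true_and, Finset.mem_erase]
      tauto
    rw [hsub, Finset.card_erase_add_one hAmem]
  have hPlt : P < ⊤ := by
    apply lt_of_le_of_ne le_top
    intro htop
    have h1 : Module.finrank ℂ P ≤ gens.card := finrank_span_finset_le_card gens
    have h2 : Module.finrank ℂ (Tq → ℂ) = Fintype.card Tq := Module.finrank_fintype_fun_eq_card ℂ
    rw [htop, finrank_top] at h1
    omega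
  obtain ⟨κ, hκne, hκ⟩ := Submodule.exists_le_ker_of_lt_top P hPlt
  -- the functional `θ = κ ∘ E` on functions on the ball
  let Eop : (Bt → ℂ) → (Tq → ℂ) := fun g R => peelOp w q₂ (peelOp w q₁ (extBall t g)) R.1
  have hEadd : ∀ g g', Eop (g + g') = Eop g + Eop g' := by
    intro g g'; funext R
    simp only [Eop, Pi.add_apply]
    have hext : extBall t (g + g') = extBall t g + extBall t g' := by
      funext X; simp only [extBall, Pi.add_apply]; split_ifs <;> simp
    rw [hext, peelOp_fun_congr w q₂ (fun X => peelOp_add w q₁ _ _ X), ← peelOp_add]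
    rfl
  have hEsmul : ∀ (a : ℂ) g, Eop (a • g) = a • Eop g := by
    intro a g; funext R
    simp only [Eop, Pi.smul_apply, smul_eq_mul]
    have hext : extBall t (a • g) = a • extBall t g := by
      funext X; simp only [extBall, Pi.smul_apply, smul_eq_mul]; split_ifs <;> simp
    rw [hext, peelOp_fun_congr w q₂ (fun X => peelOp_smul w q₁ a _ X)]
    have : (fun X => a * peelOp w q₁ (extBall t g) X) = a • (fun X => peelOp w q₁ (extBall t g) X) := by
      funext X; simp
    rw [this, peelOp_smul]
  let θ : (Bt → ℂ) →ₗ[ℂ] ℂ :=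
    { toFun := fun g => κ (Eop g)
      map_add' := fun g g' => by simp only [hEadd, map_add]
      map_smul' := fun a g => by simp only [hEsmul, map_smul, RingHom.id_apply] }
  -- `E` on the coefficient vector of a row
  have hEv : ∀ i (R : Tq), Eop (v i) R = if q₁ ∉ u i ∧ q₂ ∉ u i then coef w (u i) R.1 else 0 := by
    intro i R
    have hagree : ∀ X : Finset ι, X.card = R.1.card → extBall t (v i) X = coef w (u i) X := by
      intro X hX
      simp only [extBall, v]
      rw [dif_pos (by rw [hX, R.2.1])]
    simp only [Eop]
    rw [doublePeel_congr_card w hne R.2.2.1 R.2.2.2 hagree]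
    exact doublePeel_coef_row w hne hcol₁ hcol₂ hq₁ hq₂ hdisj (hshape i).1 (hshape i).2 R.2.1 R.2.2.1 R.2.2.2
  -- `θ` kills every row vector
  have hθv : ∀ i, θ (v i) = 0 := by
    intro i
    change κ (Eop (v i)) = 0
    by_cases hfree : q₁ ∉ u i ∧ q₂ ∉ u i
    · by_cases hcard : (u i).card = t
      · -- a generator of `P`
        have hmem : Eop (v i) ∈ P := by
          apply Submodule.subset_span
          rw [hgens, Finset.coe_image]
          refine ⟨u i, ?_, ?_⟩
          · rw [Finset.coe_filter]; exact ⟨Finset.mem_univ _, hcard, hfree.1, hfree.2, hA i⟩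
          · funext R; rw [hEv, if_pos hfree]
        exact LinearMap.mem_ker.1 (hκ hmem)
      · have hlt : (u i).card < t := by
          have h1 := (hshape i).1
          rcases Nat.lt_or_ge (u i).card (t + 1) with h | h
          · by_contra h'; exact hcard (by omega)
          · exact absurd ((hshape i).2 (by omega)).1 hfree.1
        have : Eop (v i) = 0 := by
          funext R; rw [hEv, if_pos hfree, Pi.zero_apply]
          exact coef_eq_zero_of_card_lt w (by rw [R.2.1]; exact hlt)
        rw [this, map_zero]
    · have : Eop (v i) = 0 := by funext R; rw [hEv, if_neg hfree, Pi.zero_apply]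
      rw [this, map_zero]
  -- `θ ≠ 0`
  have hθne : θ ≠ 0 := by
    obtain ⟨hfun, hh⟩ : ∃ hfun : Tq → ℂ, κ hfun ≠ 0 := by
      by_contra hno; push Not at hno
      exact hκne (LinearMap.ext hno)
    let g₀ : Bt → ℂ := fun R => if hR : R.1.card = t ∧ q₁ ∉ R.1 ∧ q₂ ∉ R.1 then hfun ⟨R.1, hR⟩ else 0
    have hzero : ∀ X : Finset ι, (q₁ ∈ X ∨ q₂ ∈ X) → extBall t g₀ X = 0 := by
      intro X hX
      simp only [extBall, g₀]
      split_ifs with h1 h2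
      · exfalso; rcases hX with h | h
        · exact h2.2.1 h
        · exact h2.2.2 h
      · rfl
      · rfl
    have hE : Eop g₀ = hfun := by
      funext R
      have hP1zero : ∀ Y : Finset ι, q₂ ∈ Y → peelOp w q₁ (extBall t g₀) Y = 0 := by
        intro Y hY
        simp only [peelOp]
        rw [hzero Y (Or.inr hY), Finset.sum_eq_zero, sub_zero]
        intro d _; rw [hzero _ (Or.inl (Finset.mem_insert_self _ _)), mul_zero]
      have hP1R : peelOp w q₁ (extBall t g₀) R.1 = hfun R := by
        simp only [peelOp]
        rw [Finset.sum_eq_zero (fun d _ => by rw [hzero _ (Or.inl (Finset.mem_insert_self _ _)), mul_zero]), sub_zero]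
        simp only [extBall, g₀]
        rw [dif_pos (by rw [R.2.1]), dif_pos ⟨R.2.1, R.2.2.1, R.2.2.2⟩]
      change peelOp w q₁ (extBall t g₀) R.1 -
          ∑ d ∈ R.1, w q₂ d * peelOp w q₁ (extBall t g₀) (insert q₂ (R.1.erase d)) = hfun R
      rw [hP1R, Finset.sum_eq_zero (fun d _ => by rw [hP1zero _ (Finset.mem_insert_self _ _), mul_zero]), sub_zero]
    intro hθ
    apply hh
    have : θ g₀ = 0 := by rw [hθ]; rfl
    change κ (Eop g₀) = 0 at this
    rwa [hE] at this
  -- dimension count: the `r` vectors `v i` lie in `ker θ`, of dimension `< |Bt| ≤ r`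
  have hBt_le : Fintype.card Bt ≤ r := by
    classical
    let f : Bt → Fin r := fun R => if hRA : R.1 = A then i₀ else Classical.choose (hall R.1 R.2 hRA)
    refine (Fintype.card_le_of_injective f fun R R' hRR' => ?_).trans (by rw [Fintype.card_fin])
    by_cases hRA : R.1 = A <;> by_cases hR'A : R'.1 = A
    · exact Subtype.ext (hRA.trans hR'A.symm)
    · exfalso
      have h1 : f R = i₀ := by simp only [f, dif_pos hRA]
      have hs := Classical.choose_spec (hall R'.1 R'.2 hR'A)
      have h2 : f R' = Classical.choose (hall R'.1 R'.2 hR'A) := by simp only [f, dif_neg hR'A]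
      exact hs.1 (by rw [← h2, ← hRR', h1])
    · exfalso
      have h1 : f R' = i₀ := by simp only [f, dif_pos hR'A]
      have hs := Classical.choose_spec (hall R.1 R.2 hRA)
      have h2 : f R = Classical.choose (hall R.1 R.2 hRA) := by simp only [f, dif_neg hRA]
      exact hs.1 (by rw [← h2, hRR', h1])
    · have hs := Classical.choose_spec (hall R.1 R.2 hRA)
      have hs' := Classical.choose_spec (hall R'.1 R'.2 hR'A)
      have h2 : f R = Classical.choose (hall R.1 R.2 hRA) := by simp only [f, dif_neg hRA]
      have h2' : f R' = Classical.choose (hall R'.1 R'.2 hR'A) := by simp only [f, dif_neg hR'A]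
      apply Subtype.ext
      rw [← hs.2, ← hs'.2, ← h2, ← h2', hRR']
  have hdep : ¬ LinearIndependent ℂ v := by
    intro hli
    rw [linearIndependent_iff_card_le_finrank_span, Fintype.card_fin] at hli
    have hle : Set.finrank ℂ (Set.range v) ≤ Module.finrank ℂ (LinearMap.ker θ) := by
      apply Submodule.finrank_mono
      rw [Submodule.span_le]
      rintro _ ⟨i, rfl⟩
      exact LinearMap.mem_ker.2 (hθv i)
    have hker : LinearMap.ker θ < ⊤ := lt_top_iff_ne_top.2 (fun h => hθne (LinearMap.ker_eq_top.1 h))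
    have hlt := Submodule.finrank_lt_finrank_of_lt hker
    rw [finrank_top, Module.finrank_fintype_fun_eq_card] at hlt
    omega
  obtain ⟨g, hg, i₁, hi₁⟩ := Fintype.not_linearIndependent_iff.1 hdep
  -- the relation transfers to the rows of the monomial matrix
  set M : Matrix (Fin r) (Fin r) ℂ := Matrix.of fun i kk : Fin r => ∏ a ∈ u i, ∑ q ∈ colJ kk, w a q with hM
  have hrow : ∀ i kk, M i kk = ∑ X ∈ (colJ kk).powerset, coef w (u i) X := by
    intro i kk
    rw [hM, Matrix.of_apply, mono_expand]
    have h1 : ∀ φ ∈ Fintype.piFinset (fun a => if a ∈ u i then (Finset.univ : Finset ι) else {a}),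
        (∏ a ∈ u i, w a (φ a)) * (if ∀ a ∈ u i, φ a ∈ colJ kk then (1 : ℂ) else 0) =
        (∏ a ∈ u i, w a (φ a)) * (if (u i).image φ ⊆ colJ kk then (1 : ℂ) else 0) := by
      intro φ _; congr 1; simp only [Finset.image_subset_iff]
    rw [Finset.sum_congr rfl h1, sum_maps_eq_sum_coef w (fun X => if X ⊆ colJ kk then (1 : ℂ) else 0) (u i)]
    rw [← Finset.sum_subset (Finset.subset_univ (colJ kk).powerset)]
    · exact Finset.sum_congr rfl fun X hX => by rw [if_pos (Finset.mem_powerset.1 hX), mul_one]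
    · intro X _ hX; rw [if_neg (fun h => hX (Finset.mem_powerset.2 h)), mul_zero]
  have hrel : Matrix.vecMul g M = 0 := by
    funext kk
    rw [Matrix.vecMul, dotProduct, Pi.zero_apply]
    calc ∑ i, g i * M i kk = ∑ i, ∑ X ∈ (colJ kk).powerset, g i * coef w (u i) X :=
          Finset.sum_congr rfl fun i _ => by rw [hrow, Finset.mul_sum]
      _ = ∑ X ∈ (colJ kk).powerset, ∑ i, g i * coef w (u i) X := Finset.sum_comm
      _ = 0 := by
          refine Finset.sum_eq_zero fun X hX => ?_
          have hXt : X.card ≤ t := (Finset.card_le_card (Finset.mem_powerset.1 hX)).trans (hcol kk)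
          have := congrFun hg ⟨X, hXt⟩
          simpa [v, Finset.sum_apply, Pi.smul_apply, smul_eq_mul] using this
  by_contra hdet
  have hU : IsUnit M := (Matrix.isUnit_iff_isUnit_det M).2 (isUnit_iff_ne_zero.2 hdet)
  have hinj := Matrix.vecMul_injective_iff_isUnit.2 hU
  have hg0 : g = 0 := hinj (hrel.trans (Matrix.zero_vecMul M).symm)
  exact hi₁ (by rw [hg0]; rfl)

end SecondShell

end

end Summit.ValiantsHypothesis.ValiantsHypothesis.Theorems.BarrierLever.HiddenStates
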